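import Mathlib
import HarnessLib
import Summits.ResolutionOfSingularities.ResolutionOfSingularities.Theorems.WildQuotientsWildQuotientResolutionS1aWinsOfAuxReachRule

/-!
# W4.5c — A-v11 SIG: the ∃-CLASS form `AuxWithinIn` of the AUX stub (skeleton v11 statement of record)

[OURS · L1 W4.5c · res-L1-w45c-plan-1 g14 · counted 0 · statements + ported proofs (NO sorry); NOT a statement of any manuscript; AI-level work,
weaker than expert review.] Crux `stmt-ResolutionOfSingularities-17941` `CyclicQuotientFourfolds`, line `s1a-logminvertex` v10 → v11, A-side.
Companion memo: `Cruxes/CyclicQuotientFourfolds/Lines/s1a-logminvertex-A-TRAP-v1.md` §7 (why: §1–§2 of that memo exhibit SEMISIMPLE TRAPS — bad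
curves with `θ̃` of non-nilpotent linear part — that are reachable from the generic two-plane node by three legal `(a′)₁`-admissible, `jInf`-monotone
aux moves; at such points no `δ ≥ 1` centre is admissible and no `θ̃`-stable move resolves, so the registered UNIVERSAL statement
`AuxWithinReachAux p` (a certificate at EVERY aux-reachable model) is presumably false, while the strategy only ever needs certificates at the models
IT visits).

THE RE-CUT. The strategy names its own class `P` of models: `P` contains the initial model, sits inside `ReachableAux` (so the KILL stub, stated over
`ReachableAux`, applies on `P`), is closed under KILL moves (blow-ups of principal centres), and at every `P`-model with `jInf ≠ ⊥` there is a bounded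
AUX-TOP or AUX-ORBIT certificate ALL OF WHOSE MOVES STAY IN `P` (`…In P` predicates = the registered ones of `…S1aSeqRule` / `…S1aAuxTop` /
`…S1aAuxOrbit` / `…S1aOrbitRule` with the conjunct `P M'` added to every `∀ M', M.IsMoveOf M' 𝒦 d → …` clause). `AuxWithinIn p` holds iff SOME
two-phase strategy of the registered shape wins from the initial model of every datum — no spurious universality over positions the strategy never
visits. Intended witness: `P` := the NIL models (pro-nilpotent `θ̃` at every bad point) reachable by TRIANGULAR aux moves and kills (A-TRAP v1 §6, the
A-NIL lemma). Nothing proved so far is lost: `auxWithinIn_of_auxWithinReachAux` (old ⇒ new with `P := ReachableAux M₀`).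

* §1 the `…In P` predicates `AuxAltIn`, `AuxAltWithinIn`, `AuxTopAtIn`, `AuxTopWithinIn`, `AuxOrbitAtIn`, `AuxOrbitWithinIn`;
* §2 the research statement `AuxWithinIn p` (binders VERBATIM those of `AuxWithinReachAux`);
* §3 the lemmas of lead-1's file `…S1aWithinIn.lean` (A-v11), ALL PROVED HERE by porting the registered proofs: `lex_lt_of_move_of_auxOrbitAtIn`,
  `auxAltIn_of_auxTopAtIn`, `auxAltWithinIn_of_auxTopWithinIn`, ★★ `wins_of_touchOrTopOrOrbitSeq_in` (the `_aux` nested induction VERBATIM; its six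
  `hPmove` calls are fed by the kill-closure hypothesis resp. the `P M'` conjuncts of the certificates), `auxWithinIn_of_auxWithinReachAux`. Skeleton v11 = v10 with `stub_auxWithinIn : ∀ p, p.Prime → AuxWithinIn p`
  replacing `stub_auxWithinReachAux`; `stub_winningStrategy` re-derived from K ∧ `AuxWithinIn` exactly as in v10 (p627065 pattern);
* §4 PROVED `winningStrategy_of_killTouchReachAux_of_auxWithinIn` (K ∧ `AuxWithinIn p` ⇒ `FrameWins.WinningStrategy p`) and
  `cyclicQuotientFourfolds_of_door_of_killTouchReachAux_of_auxWithinIn` — so A-v11 for lead-1 is a pure FILING job (move §1–§4 into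
  `Theorems/…S1aWithinIn.lean`), after which the planner registers skeleton v11.
-/

set_option linter.dupNamespace false

noncomputable section

open CategoryTheory Limits AlgebraicGeometry TopologicalSpace Topology
open Literature.AlgebraicGeometry.Resolution Literature.AlgebraicGeometry.RelativeSpec
open Summit.ResolutionOfSingularities.ResolutionOfSingularities.Theorems.WildQuotientResolution.S1
open Summit.ResolutionOfSingularities.ResolutionOfSingularities.Theorems.WildQuotientResolution.S1.NodeAtlas
open Summit.ResolutionOfSingularities.ResolutionOfSingularities.Theorems.WildQuotientResolution.S1.G1Proof
open Summit.ResolutionOfSingularities.ResolutionOfSingularities.Theorems.WildQuotientResolution.S1.CompCount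
open Summit.ResolutionOfSingularities.ResolutionOfSingularities.Theorems.WildQuotientResolution.S1.TopComponents

namespace Summit.ResolutionOfSingularities.ResolutionOfSingularities.Theorems.WildQuotientResolution.S1

namespace GameFrame.GModel.WithinInSig

variable {p : ℕ} {X' X₁ : Scheme.{0}} {q : X' ⟶ X₁} {G : Type} [Group G] {ρ : G →* Aut X'} {g₀ : G}

/-! ## §1 The `…In P` predicates -/

/-- `AuxAltIn P M`: `AuxAlt M` whose moves all land in `P`. [OURS · L1 W4.5c · A-v11 SIG] -/
def AuxAltIn (P : GModel p q G ρ g₀ → Prop) (M : GModel p q G ρ g₀) : Prop :=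
  ∃ (𝒦 : ReesFiltration M.V) (d : ℕ), IsAuxCentre p M.act g₀ 𝒦 d (M.badLocus)ᶜ ∧
    ∀ M' : GModel p q G ρ g₀, M.IsMoveOf M' 𝒦 d → M'.jInf < M.jInf ∧ P M'

/-- `AuxAltWithinIn P n M`: `AuxAltWithin n M` whose moves all land in `P`. [OURS · L1 W4.5c · A-v11 SIG] -/
def AuxAltWithinIn (P : GModel p q G ρ g₀ → Prop) : ℕ → GModel p q G ρ g₀ → Prop
  | 0, M => AuxAltIn P M
  | n + 1, M => AuxAltIn P M ∨
      ∃ (𝒦 : ReesFiltration M.V) (d : ℕ), IsAuxCentre p M.act g₀ 𝒦 d (M.badLocus)ᶜ ∧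
        ∀ M' : GModel p q G ρ g₀, M.IsMoveOf M' 𝒦 d → M'.jInf ≤ M.jInf ∧ P M' ∧ AuxAltWithinIn P n M'

/-- `AuxTopAtIn P M`: `AuxTopAt M` (verbatim) plus: every move of the certificate's centre lands in `P`. [OURS · L1 W4.5c · A-v11 SIG] -/
def AuxTopAtIn (P : GModel p q G ρ g₀ → Prop) (M : GModel p q G ρ g₀) : Prop :=
  ∃ (𝒦 : ReesFiltration M.V) (d : ℕ), IsAuxCentre p M.act g₀ 𝒦 d (M.badLocus)ᶜ ∧
    (∀ M' : GModel p q G ρ g₀, M.IsMoveOf M' 𝒦 d → P M') ∧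
    ∃ Z : Set M.V, IsClosed Z ∧ (∀ g : G, (M.act.aut g).hom.base ⁻¹' Z = Z) ∧ Z ⊆ M.nonKillable ∧
      topologicalKrullDim ↥(M.nonKillable \ Z) < M.jInf ∧ Z ⊆ ((𝒦.ideal d).support : Set M.V) ∧
      ∀ (M' : GModel p q G ρ g₀) (π' : M'.V ⟶ M.V), IsBlowup π' (𝒦.ideal d) → M'.π = π' ≫ M.π → M'.r = π' ≫ M.r →
        (∀ g : G, (M'.act.aut g).hom ≫ π' = π' ≫ (M.act.aut g).hom) →
        ∀ v' ∈ M'.badLocus, π'.base v' ∈ ((𝒦.ideal d).support : Set M.V) → M'.KillableAt v'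

/-- `AuxTopWithinIn P n M`: `AuxTopWithin n M` whose moves all land in `P`. [OURS · L1 W4.5c · A-v11 SIG] -/
def AuxTopWithinIn (P : GModel p q G ρ g₀ → Prop) : ℕ → GModel p q G ρ g₀ → Prop
  | 0, M => AuxTopAtIn P M
  | n + 1, M => AuxTopAtIn P M ∨
      ∃ (𝒦 : ReesFiltration M.V) (d : ℕ), IsAuxCentre p M.act g₀ 𝒦 d (M.badLocus)ᶜ ∧
        ∀ M' : GModel p q G ρ g₀, M.IsMoveOf M' 𝒦 d → M'.jInf ≤ M.jInf ∧ P M' ∧ AuxTopWithinIn P n M'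

/-- `AuxOrbitAtIn P M`: `AuxOrbitAt M` (verbatim) plus: every move of the certificate's centre lands in `P`. [OURS · L1 W4.5c · A-v11 SIG] -/
def AuxOrbitAtIn (P : GModel p q G ρ g₀ → Prop) (M : GModel p q G ρ g₀) : Prop :=
  ∃ (𝒦 : ReesFiltration M.V) (d : ℕ), IsAuxCentre p M.act g₀ 𝒦 d (M.badLocus)ᶜ ∧
    (∀ M' : GModel p q G ρ g₀, M.IsMoveOf M' 𝒦 d → P M') ∧
    (∃ t ∈ irreducibleComponents ↥M.nonKillable, topologicalKrullDim ↥t = M.jInf ∧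
      Subtype.val '' t ⊆ ((𝒦.ideal d).support : Set M.V)) ∧
    ∀ (M' : GModel p q G ρ g₀) (π' : M'.V ⟶ M.V), IsBlowup π' (𝒦.ideal d) → M'.π = π' ≫ M.π → M'.r = π' ≫ M.r →
      (∀ g : G, (M'.act.aut g).hom ≫ π' = π' ≫ (M.act.aut g).hom) →
      ∀ v' ∈ M'.badLocus, π'.base v' ∈ ((𝒦.ideal d).support : Set M.V) → M'.KillableAt v'

/-- `AuxOrbitWithinIn P n M`: `AuxOrbitWithin n M` whose moves all land in `P`. [OURS · L1 W4.5c · A-v11 SIG] -/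
def AuxOrbitWithinIn (P : GModel p q G ρ g₀ → Prop) : ℕ → GModel p q G ρ g₀ → Prop
  | 0, M => AuxOrbitAtIn P M
  | n + 1, M => AuxOrbitAtIn P M ∨
      ∃ (𝒦 : ReesFiltration M.V) (d : ℕ), IsAuxCentre p M.act g₀ 𝒦 d (M.badLocus)ᶜ ∧
        ∀ M' : GModel p q G ρ g₀, M.IsMoveOf M' 𝒦 d →
          (M'.jInf < M.jInf ∨ (M'.jInf = M.jInf ∧ M'.topCount ≤ M.topCount)) ∧ P M' ∧ AuxOrbitWithinIn P n M'

/-! ## §3 the lemmas of lead-1's `…S1aWithinIn.lean` (ported proofs) -/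

/-- Forgetting `P`. -/
theorem auxTopAt_of_auxTopAtIn {P : GModel p q G ρ g₀ → Prop} {M : GModel p q G ρ g₀} (h : AuxTopAtIn P M) : M.AuxTopAt := by
  obtain ⟨𝒦, d, haux, -, hrest⟩ := h
  exact ⟨𝒦, d, haux, hrest⟩

/-- Forgetting `P`. -/
theorem auxOrbitAt_of_auxOrbitAtIn {P : GModel p q G ρ g₀ → Prop} {M : GModel p q G ρ g₀} (h : AuxOrbitAtIn P M) : M.AuxOrbitAt := by
  obtain ⟨𝒦, d, haux, -, ht, hkill⟩ := h
  exact ⟨𝒦, d, haux, ht, hkill⟩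

/-- ★ In-variant of `lex_lt_of_move_of_auxOrbitAt` (same proof, the `P M'` conjunct carried along). -/
theorem lex_lt_of_move_of_auxOrbitAtIn [Finite G] (hp : p.Prime) (hG : ∀ g : G, g ∈ Subgroup.zpowers g₀) (P : GModel p q G ρ g₀ → Prop)
    (M : GModel p q G ρ g₀) (hB : M.HasNoetherianBase) [CompactSpace M.V] {k : ℕ} (hk : M.jInf = k) (h : AuxOrbitAtIn P M) :
    ∃ (𝒦 : ReesFiltration M.V) (d : ℕ), IsAuxCentre p M.act g₀ 𝒦 d (M.badLocus)ᶜ ∧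
      ∀ M' : GModel p q G ρ g₀, M.IsMoveOf M' 𝒦 d → (M'.jInf < M.jInf ∨ (M'.jInf = M.jInf ∧ M'.topCount < M.topCount)) ∧ P M' := by
  obtain ⟨𝒦, d, haux, hP, ⟨t, ht, hdt, htsupp⟩, hkill⟩ := h
  refine ⟨𝒦, d, haux, fun M' hmv => ⟨?_, hP M' hmv⟩⟩
  obtain ⟨π', hbl, hπ, hr, hcomm⟩ := hmv
  exact lex_lt_of_move_of_killable_over_support hp hG M M' hB hk 𝒦 d (fun g => haux.1.2.1 g d) ht hdt htsupp π' hbl hr hcomm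
    (hkill M' π' hbl hπ hr hcomm)

/-- In-variant of `auxAlt_of_auxTopAt` (same proof, `P M'` carried along). -/
theorem auxAltIn_of_auxTopAtIn [Finite G] (hp : p.Prime) (hG : ∀ g : G, g ∈ Subgroup.zpowers g₀) {P : GModel p q G ρ g₀ → Prop}
    (M : GModel p q G ρ g₀) (hB : M.HasNoetherianBase) (h : AuxTopAtIn P M) : AuxAltIn P M := by
  obtain ⟨𝒦, d, haux, hP, Z, -, -, -, hdim, hZ, hkill⟩ := h
  refine ⟨𝒦, d, haux, fun M' hmv => ⟨?_, hP M' hmv⟩⟩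
  obtain ⟨π', hbl, hπ, hr, hcomm⟩ := hmv
  exact jInf_lt_of_move_of_killable_over_support hp hG M M' hB 𝒦 d (fun g => haux.1.2.1 g d) π' hbl hr hcomm
    (hkill M' π' hbl hπ hr hcomm) hZ hdim

/-- In-variant of `auxAltWithin_of_auxTopWithin` (same induction, `P M'` carried along). -/
theorem auxAltWithinIn_of_auxTopWithinIn [Finite G] (hp : p.Prime) (hG : ∀ g : G, g ∈ Subgroup.zpowers g₀) {P : GModel p q G ρ g₀ → Prop}
    (hB : ∀ M : GModel p q G ρ g₀, M.HasNoetherianBase) :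
    ∀ (n : ℕ) (M : GModel p q G ρ g₀), AuxTopWithinIn P n M → AuxAltWithinIn P n M
  | 0, M, h => auxAltIn_of_auxTopAtIn hp hG M (hB M) h
  | n + 1, M, h => by
      rcases h with h | ⟨𝒦, d, haux, hmv⟩
      · exact Or.inl (auxAltIn_of_auxTopAtIn hp hG M (hB M) h)
      · exact Or.inr ⟨𝒦, d, haux, fun M' hm =>
          ⟨(hmv M' hm).1, (hmv M' hm).2.1, auxAltWithinIn_of_auxTopWithinIn hp hG hB n M' (hmv M' hm).2.2⟩⟩

/-- ★★ **TOUCH-KILL ∨ bounded AUX-TOP ∨ bounded AUX-ORBIT sequence WINS, for a class closed under KILL moves only, the aux certificates keeping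
their moves inside the class.** Proof = `wins_of_touchOrTopOrOrbitSeq_aux` VERBATIM, its six `hPmove` calls (`…S1aReachAux` l.≈35, 40, 42, 60, 73, 89)
fed by `hPkill` (kill branch, the principal centre of `H`) resp. the `P M'` conjuncts of `AuxAltIn` / `AuxAltWithinIn` /
`lex_lt_of_move_of_auxOrbitAtIn` / `AuxOrbitWithinIn`. [OURS · L1 W4.5c · A-v11 SIG] -/
theorem wins_of_touchOrTopOrOrbitSeq_in [Finite G] (hp : p.Prime) (hG : ∀ g : G, g ∈ Subgroup.zpowers g₀) (P : GModel p q G ρ g₀ → Prop)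
    (hPkill : ∀ (M M' : GModel p q G ρ g₀) (𝒦 : ReesFiltration M.V) (d : ℕ),
      P M → IsPrincipalCentre p M.act g₀ 𝒦 d → M.IsMoveOf M' 𝒦 d → P M')
    (hB : ∀ M : GModel p q G ρ g₀, P M → M.HasNoetherianBase) (hnu : ∀ M : GModel p q G ρ g₀, P M → ∃ n : ℕ, M.nu1 < n)
    (hcpt : ∀ M : GModel p q G ρ g₀, P M → CompactSpace M.V)
    (H : ∀ M : GModel p q G ρ g₀, P M → ¬ M.Terminal →
      (M.jInf = ⊥ ∧ ∃ (𝒦 : ReesFiltration M.V) (d : ℕ), IsPrincipalCentre p M.act g₀ 𝒦 d ∧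
        (M.badLocus ∩ ((𝒦.ideal d).support : Set M.V)).Nonempty) ∨
      (∃ n : ℕ, AuxAltWithinIn P n M) ∨ (∃ n : ℕ, AuxOrbitWithinIn P n M))
    (M₀ : GModel p q G ρ g₀) (hP₀ : P M₀) : Wins p q G ρ g₀ M₀ := by
  have hfin : ∀ M : GModel p q G ρ g₀, P M → (irreducibleComponents ↥M.badLocus).Finite := fun M hPM => by
    haveI := hcpt M hPM
    exact M.finite_irreducibleComponents_badLocus
  obtain ⟨n₀, hn₀⟩ := hnu M₀ hP₀
  suffices main : ∀ (a : ℕ) (M : GModel p q G ρ g₀), P M → M.jInf < a → Wins p q G ρ g₀ M from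
    main n₀ M₀ hP₀ (lt_of_le_of_lt M₀.jInf_le_nu1 hn₀)
  intro a
  induction a using Nat.strong_induction_on with
  | _ a iha =>
    have drop : ∀ M M' : GModel p q G ρ g₀, P M' → M.jInf < a → M'.jInf < M.jInf → Wins p q G ρ g₀ M' := fun M M' hP' ha hj => by
      cases a with
      | zero => exact absurd (withBot_eq_bot_of_lt_zero ha ▸ hj) not_lt_bot
      | succ a' => exact iha a' (Nat.lt_succ_self a') M' hP' (lt_of_lt_of_le hj (withBot_le_of_lt_succ ha))
    have seqTop : ∀ (n : ℕ) (M : GModel p q G ρ g₀), P M → M.jInf < a → AuxAltWithinIn P n M → Wins p q G ρ g₀ M := by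
      intro n
      induction n with
      | zero =>
        intro M hPM ha h
        obtain ⟨𝒦, d, haux, hmoves⟩ := h
        exact Wins.of_moves 𝒦 d haux.1 fun M' hmv => drop M M' (hmoves M' hmv).2 ha (hmoves M' hmv).1
      | succ n ihn =>
        intro M hPM ha h
        rcases h with h | ⟨𝒦, d, haux, hmoves⟩
        · obtain ⟨𝒦, d, haux, hmoves⟩ := h
          exact Wins.of_moves 𝒦 d haux.1 fun M' hmv => drop M M' (hmoves M' hmv).2 ha (hmoves M' hmv).1
        · exact Wins.of_moves 𝒦 d haux.1 fun M' hmv =>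
            ihn M' (hmoves M' hmv).2.1 (lt_of_le_of_lt (hmoves M' hmv).1 ha) (hmoves M' hmv).2.2
    have level : ∀ (b : ℕ) (M : GModel p q G ρ g₀), P M → M.jInf < a → M.topCount < b → Wins p q G ρ g₀ M := by
      intro b
      induction b with
      | zero => exact fun M _ _ hb => absurd hb (Nat.not_lt_zero _)
      | succ b ihb =>
        have orbAt : ∀ M : GModel p q G ρ g₀, P M → M.jInf < a → M.topCount ≤ b → AuxOrbitAtIn P M → Wins p q G ρ g₀ M := by
          intro M hPM ha hb h
          haveI := hcpt M hPM
          have hne : M.jInf ≠ ⊥ := by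
            obtain ⟨-, -, -, -, ⟨t, ht, -, -⟩, -⟩ := h
            intro hbot
            rw [jInf, topologicalKrullDim, Order.krullDim_eq_bot_iff] at hbot
            obtain ⟨x, -⟩ := ht.1.nonempty
            exact hbot.elim ⟨closure {x}, isIrreducible_singleton.closure, isClosed_closure⟩
          obtain ⟨k, hk⟩ := exists_nat_eq_of_ne_bot_of_lt hne ha
          obtain ⟨𝒦, d, haux, hmoves⟩ := lex_lt_of_move_of_auxOrbitAtIn hp hG P M (hB M hPM) hk h
          refine Wins.of_moves 𝒦 d haux.1 fun M' hmv => ?_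
          have hPM' := (hmoves M' hmv).2
          rcases (hmoves M' hmv).1 with hlt | ⟨heq, hlt⟩
          · exact drop M M' hPM' ha hlt
          · exact ihb M' hPM' (heq ▸ ha) (lt_of_lt_of_le hlt hb)
        have seqOrb : ∀ (n : ℕ) (M : GModel p q G ρ g₀), P M → M.jInf < a → M.topCount ≤ b → AuxOrbitWithinIn P n M →
            Wins p q G ρ g₀ M := by
          intro n
          induction n with
          | zero => exact fun M hPM ha hb h => orbAt M hPM ha hb h
          | succ n ihn =>
            intro M hPM ha hb h
            rcases h with h | ⟨𝒦, d, haux, hmoves⟩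
            · exact orbAt M hPM ha hb h
            · refine Wins.of_moves 𝒦 d haux.1 fun M' hmv => ?_
              obtain ⟨hlex, hPM', hwithin⟩ := hmoves M' hmv
              rcases hlex with hlt | ⟨heq, hle⟩
              · exact drop M M' hPM' ha hlt
              · exact ihn M' hPM' (heq ▸ ha) (hle.trans hb) hwithin
        have kill : ∀ (c : ℕ) (M : GModel p q G ρ g₀), P M → M.jInf < a → M.topCount ≤ b → nIrrComp ↥M.badLocus < c →
            Wins p q G ρ g₀ M := by
          intro c
          induction c with
          | zero => exact fun M _ _ _ hc => absurd hc (Nat.not_lt_zero _)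
          | succ c ihc =>
            intro M hPM ha hb hc
            by_cases hT : M.Terminal
            · exact Wins.terminal M hT
            rcases H M hPM hT with ⟨hbot, 𝒦, d, hprin, htouch⟩ | ⟨n, hn⟩ | ⟨n, hn⟩
            · refine Wins.of_moves 𝒦 d (isAdmissibleCentre_of_isPrincipalCentre hprin) fun M' hmv => ?_
              have hPM' := hPkill M M' 𝒦 d hPM hprin hmv
              have hj : M'.jInf ≤ M.jInf := jInf_move_le hp hG M M' 𝒦 d hprin (hB M hPM) hmv
              have hbot' : M'.jInf = ⊥ := le_bot_iff.mp (hbot ▸ hj)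
              exact ihc M' hPM' (lt_of_le_of_lt hj ha) (by rw [M'.topCount_eq_zero_of_jInf_eq_bot hbot']; exact Nat.zero_le _)
                (lt_of_lt_of_le (nIrrComp_badLocus_principalMove_lt hp hG M M' 𝒦 d hprin (hB M hPM) (hfin M hPM) htouch hmv)
                  (Nat.lt_succ_iff.mp hc))
            · exact seqTop n M hPM ha hn
            · exact seqOrb n M hPM ha hb hn
        intro M hPM ha hb
        exact kill (nIrrComp ↥M.badLocus + 1) M hPM ha (Nat.lt_succ_iff.mp hb) (Nat.lt_succ_self _)
    intro M hPM ha
    exact level (M.topCount + 1) M hPM ha (Nat.lt_succ_self _)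

end GameFrame.GModel.WithinInSig

/-! ## §2 The research statement `AuxWithinIn p` (skeleton v11) -/

open GameFrame.GModel.WithinInSig in
/-- **`AuxWithinIn p`** (A-v11; OURS CANDIDATE research statement, asserted nowhere): for every datum of the crux there is a class `P` of models —
containing the initial model, inside `ReachableAux`, closed under KILL moves — such that every non-terminal `P`-model with `jInf ≠ ⊥` carries a bounded
AUX-TOP or AUX-ORBIT certificate all of whose moves stay in `P`. Binders VERBATIM those of `AuxWithinReachAux`. [OURS · L1 W4.5c · A-v11 SIG] -/
def AuxWithinIn (p : ℕ) : Prop :=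
  ∀ (k : Type) [Field k] [CharP k p] [PerfectField k] (X' X₁ : Scheme.{0})
    (f : X₁ ⟶ Spec (.of k)) (q : X' ⟶ X₁) (G : Type) [Group G] [Finite G]
    (ρ : G →* Aut X'), Nat.card G = p → IsSeparated f → LocallyOfFiniteType f → QuasiCompact f →
    IsIntegral X₁ → ∀ [IsIntegral X'], Scheme.IsRegular X' → IsFinite q → Function.Surjective q.base →
    (∃ U : X₁.Opens, Dense (U : Set X₁) ∧ Etale (q ∣_ U)) →
    ∀ (hq : ∀ g : G, (ρ g).hom ≫ q = q),
    (∀ x y : X', q.base x = q.base y → ∃ g : G, (ρ g).hom.base x = y) →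
    topologicalKrullDim X₁ ≤ 4 → Function.Injective ρ →
    ∀ (g₀ : G), (∀ g : G, g ∈ Subgroup.zpowers g₀) → ∀ [IsLocallyNoetherian X']
      (h₀ : NodeAtlas p (⟨ρ, hq⟩ : ActionOver q G) g₀),
      ∃ P : GameFrame.GModel p q G ρ g₀ → Prop,
        P (GameFrame.GModel.initial hq h₀) ∧
        (∀ M : GameFrame.GModel p q G ρ g₀, P M → (GameFrame.GModel.initial hq h₀).ReachableAux M) ∧
        (∀ (M M' : GameFrame.GModel p q G ρ g₀) (𝒦 : ReesFiltration M.V) (d : ℕ),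
          P M → IsPrincipalCentre p M.act g₀ 𝒦 d → M.IsMoveOf M' 𝒦 d → P M') ∧
        ∀ M : GameFrame.GModel p q G ρ g₀, P M → ¬ M.Terminal → M.jInf ≠ ⊥ →
          (∃ n : ℕ, AuxTopWithinIn P n M) ∨ (∃ n : ℕ, AuxOrbitWithinIn P n M)

namespace GameFrame.GModel.WithinInSig

variable {p : ℕ} {X' X₁ : Scheme.{0}} {q : X' ⟶ X₁} {G : Type} [Group G] {ρ : G →* Aut X'} {g₀ : G}

/-- `AuxTopWithin n` at an aux-reachable model is `AuxTopWithinIn (ReachableAux M₀) n`. -/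
theorem auxTopWithinIn_reachableAux (M₀ : GModel p q G ρ g₀) :
    ∀ (n : ℕ) (M : GModel p q G ρ g₀), M₀.ReachableAux M → AuxTopWithin n M → AuxTopWithinIn M₀.ReachableAux n M
  | 0, M, hR, h => by
      obtain ⟨𝒦, d, haux, hrest⟩ := h
      exact ⟨𝒦, d, haux, fun M' hmv => ReachableAux.move 𝒦 d hR haux hmv, hrest⟩
  | n + 1, M, hR, h => by
      rcases h with h | ⟨𝒦, d, haux, hmoves⟩
      · obtain ⟨𝒦, d, haux, hrest⟩ := h
        exact Or.inl ⟨𝒦, d, haux, fun M' hmv => ReachableAux.move 𝒦 d hR haux hmv, hrest⟩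
      · exact Or.inr ⟨𝒦, d, haux, fun M' hmv => ⟨(hmoves M' hmv).1, ReachableAux.move 𝒦 d hR haux hmv,
          auxTopWithinIn_reachableAux M₀ n M' (ReachableAux.move 𝒦 d hR haux hmv) (hmoves M' hmv).2⟩⟩

/-- `AuxOrbitWithin n` at an aux-reachable model is `AuxOrbitWithinIn (ReachableAux M₀) n`. -/
theorem auxOrbitWithinIn_reachableAux (M₀ : GModel p q G ρ g₀) :
    ∀ (n : ℕ) (M : GModel p q G ρ g₀), M₀.ReachableAux M → AuxOrbitWithin n M → AuxOrbitWithinIn M₀.ReachableAux n M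
  | 0, M, hR, h => by
      obtain ⟨𝒦, d, haux, ht, hkill⟩ := h
      exact ⟨𝒦, d, haux, fun M' hmv => ReachableAux.move 𝒦 d hR haux hmv, ht, hkill⟩
  | n + 1, M, hR, h => by
      rcases h with h | ⟨𝒦, d, haux, hmoves⟩
      · obtain ⟨𝒦, d, haux, ht, hkill⟩ := h
        exact Or.inl ⟨𝒦, d, haux, fun M' hmv => ReachableAux.move 𝒦 d hR haux hmv, ht, hkill⟩
      · exact Or.inr ⟨𝒦, d, haux, fun M' hmv => ⟨(hmoves M' hmv).1, ReachableAux.move 𝒦 d hR haux hmv,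
          auxOrbitWithinIn_reachableAux M₀ n M' (ReachableAux.move 𝒦 d hR haux hmv) (hmoves M' hmv).2⟩⟩

end GameFrame.GModel.WithinInSig

open GameFrame.GModel.WithinInSig in
/-- **Nothing proved is lost**: the registered universal statement implies the ∃-class one, with `P := ReachableAux (initial)` (kill-closure via
`isAuxCentre_of_isPrincipalCentre`). [OURS · L1 W4.5c · A-v11 SIG] -/
theorem auxWithinIn_of_auxWithinReachAux {p : ℕ} (h : AuxWithinReachAux p) : AuxWithinIn p := by
  intro k _ _ _ X' X₁ f q G _ _ ρ hG hfs hflft hfqc hX₁ _ hreg hqfin hqsurj hU hq horb hdim hinj g₀ hg₀ _ h₀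
  refine ⟨(GameFrame.GModel.initial hq h₀).ReachableAux, GameFrame.GModel.ReachableAux.refl, fun M hM => hM,
    fun M M' 𝒦 d hP hprin hmv => GameFrame.GModel.ReachableAux.move 𝒦 d hP (isAuxCentre_of_isPrincipalCentre hprin _) hmv, ?_⟩
  intro M hR hT hj
  rcases h k X' X₁ f q G ρ hG hfs hflft hfqc hX₁ hreg hqfin hqsurj hU hq horb hdim hinj g₀ hg₀ h₀ M hR hT hj with ⟨n, hn⟩ | ⟨n, hn⟩
  · exact Or.inl ⟨n, auxTopWithinIn_reachableAux _ n M hR hn⟩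
  · exact Or.inr ⟨n, auxOrbitWithinIn_reachableAux _ n M hR hn⟩

/-! ## §4 The skeleton-v11 derivations: K ∧ `AuxWithinIn` ⇒ `WinningStrategy`; door + K + `AuxWithinIn` ⇒ the sub-crux -/

open GameFrame.GModel.WithinInSig in
/-- ★★ **THE TERMINATION CRUX FROM K AND THE ∃-CLASS AUX STATEMENT**: `KillTouchReachAux p ∧ AuxWithinIn p ⇒ WinningStrategy p` (`p` prime), by
`wins_of_touchOrTopOrOrbitSeq_in` with the class `P` supplied by `AuxWithinIn` (K applies on `P ⊆ ReachableAux`). Skeleton v11: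
`stub_winningStrategy := fun p hp _ => winningStrategy_of_killTouchReachAux_of_auxWithinIn hp (stub_killTouchReachAux p hp) (stub_auxWithinIn p hp)`.
[OURS · L1 W4.5c · A-v11 SIG] -/
theorem winningStrategy_of_killTouchReachAux_of_auxWithinIn {p : ℕ} (hp : p.Prime) (hK : KillTouchReachAux p) (hA : AuxWithinIn p) :
    FrameWins.WinningStrategy p := by
  intro k _ _ _ X' X₁ f q G _ _ ρ hG hfs hfft hfqc hX₁ _ hreg hqfin hqs hqet hq horb hdim hinj g₀ hg₀ _ h₀
  haveI := hfft
  haveI := hfqc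
  haveI := hqfin
  have HK := hK k X' X₁ f q G ρ hG hfs hfft hfqc hX₁ hreg hqfin hqs hqet hq horb hdim hinj g₀ hg₀ h₀
  obtain ⟨P, hP₀, hPR, hPkill, HA⟩ := hA k X' X₁ f q G ρ hG hfs hfft hfqc hX₁ hreg hqfin hqs hqet hq horb hdim hinj g₀ hg₀ h₀
  refine wins_of_touchOrTopOrOrbitSeq_in hp hg₀ P hPkill
    (fun M _ => GameFrame.GModel.hasNoetherianBase_of_datum f M) (fun M _ => GameFrame.GModel.exists_nat_nu1_lt_of_datum f M)
    (fun M _ => GameFrame.GModel.compactSpace_of_datum f M)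
    (fun M hPM hT => ?_) (GameFrame.GModel.initial hq h₀) hP₀
  by_cases hj : M.jInf = ⊥
  · exact Or.inl ⟨hj, HK M (hPR M hPM) hT hj⟩
  · rcases HA M hPM hT hj with ⟨n, hn⟩ | ⟨n, hn⟩
    · exact Or.inr (Or.inl ⟨n, auxAltWithinIn_of_auxTopWithinIn hp hg₀
        (fun M => GameFrame.GModel.hasNoetherianBase_of_datum f M) n M hn⟩)
    · exact Or.inr (Or.inr ⟨n, hn⟩)

/-- **Door + K + `AuxWithinIn` ⇒ the sub-crux `CyclicQuotientFourfolds`** (the v11 analogue of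
`cyclicQuotientFourfolds_of_door_of_killTouchReachAux_of_auxWithinReachAux`). [OURS · L1 W4.5c · A-v11 SIG] -/
theorem cyclicQuotientFourfolds_of_door_of_killTouchReachAux_of_auxWithinIn (hD : FrameWins.DoorStatement)
    (hK : ∀ p : ℕ, p.Prime → KillTouchReachAux p) (hA : ∀ p : ℕ, p.Prime → AuxWithinIn p) :
    Summit.ResolutionOfSingularities.ResolutionOfSingularities.Theses.WildQuotients.CyclicQuotientFourfolds :=
  FrameWins.cyclicQuotientFourfolds_of_door_of_wins hD fun p hp _ =>
    winningStrategy_of_killTouchReachAux_of_auxWithinIn hp (hK p hp) (hA p hp)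

end Summit.ResolutionOfSingularities.ResolutionOfSingularities.Theorems.WildQuotientResolution.S1

end
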